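import Summits.KontsevichZagierPeriods.KontsevichZagierPeriods.Theorems.MzvKernelInKZ.Negative.Core

/-!
# `MzvKernelInKZ` (stmt-KontsevichZagierPeriods-3914): negative side — rational scaling and integer division as derived rules

Companion of `Negative/Core.lean` (cdisprove unit of the crux `MzvKernelInKZ`; the Euler chain of
`EulerFour.lean`).  The scaling endomorphisms `KZ.scale a` (`[σ, f] ↦ [σ, a·f]`, `a` real
algebraic; `KZRelationsLE.lean`) preserve `KZ.relations`; here their ARITHMETIC modulo relations:
`scale a ∘ scale b ≡ scale (ab)`, `scale (a+b) ≡ scale a + scale b` (integrand additivity),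
`scale 1 ≡ id`, `scale n ≡ n • ·`; hence **INTEGER DIVISION is a derived rule of the calculus**
(`mem_relations_of_nsmul_mem`: `0 < n → n • c ∈ relations → c ∈ relations`) — the statement filed
by route FurushoPentagon as item `IntegerDivision` (stmt-3934), although "no division by integers"
is among Kontsevich–Zagier's rules.

Sources: M. Kontsevich, D. Zagier, *Periods* (2001), §1.2 (rules (1b), (2)).
-/

noncomputable section

namespace Summit.KontsevichZagierPeriods.MzvKernelInKZ.Negative

open Set MeasureTheory MvPolynomial
open Literature.NumberTheory.Transcendental
open Literature.ModelTheory.ExponentialFields (IsSemialgebraic)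

section Scaling

variable {n : ℕ}

/-- Composition of scalings on a generator. [folklore] -/
theorem scale_scale_of_sub_mem (a b : ℝ) (ha : IsAlgebraic ℚ a) (hb : IsAlgebraic ℚ b)
    (r : KZ.IntegralRep n) :
    KZ.scale a ha (KZ.scale b hb (KZ.of r)) - KZ.scale (a * b) (ha.mul hb) (KZ.of r) ∈ KZ.relations := by
  rw [KZ.scale_of, KZ.scale_of, KZ.scale_of]
  exact of_sub_of_mem_relations_of_eqOn rfl fun x _ => by
    simp only [KZ.IntegralRep.integrand_constMul]; ring

/-- A relation-valued identity between additive maps holds everywhere once it holds on generators. [folklore] -/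
theorem sub_mem_relations_of_forall_of (f g : KZ.FormalRep →+ KZ.FormalRep)
    (h : ∀ (k : ℕ) (r : KZ.IntegralRep k), f (KZ.of r) - g (KZ.of r) ∈ KZ.relations) (c : KZ.FormalRep) :
    f c - g c ∈ KZ.relations := by
  induction c using FreeAbelianGroup.induction_on with
  | zero => simp [KZ.relations.zero_mem]
  | of x => obtain ⟨k, r⟩ := x; exact h k r
  | neg x hx =>
    obtain ⟨k, r⟩ := x
    have := KZ.relations.neg_mem (h k r)
    rw [map_neg, map_neg]
    convert this using 1
    change -f (KZ.of r) - -g (KZ.of r) = _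
    abel
  | add x y hx hy =>
    rw [map_add, map_add]
    have : f x + f y - (g x + g y) = (f x - g x) + (f y - g y) := by abel
    rw [this]
    exact add_mem hx hy

/-- `scale a ∘ scale b ≡ scale (ab)` modulo relations. [folklore] -/
theorem scale_scale_sub_mem (a b : ℝ) (ha : IsAlgebraic ℚ a) (hb : IsAlgebraic ℚ b) (c : KZ.FormalRep) :
    KZ.scale a ha (KZ.scale b hb c) - KZ.scale (a * b) (ha.mul hb) c ∈ KZ.relations :=
  sub_mem_relations_of_forall_of ((KZ.scale a ha).comp (KZ.scale b hb)) (KZ.scale (a * b) (ha.mul hb))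
    (fun _ r => scale_scale_of_sub_mem a b ha hb r) c

/-- `scale (a + b) ≡ scale a + scale b` modulo relations (integrand additivity). [folklore] -/
theorem scale_add_sub_mem (a b : ℝ) (ha : IsAlgebraic ℚ a) (hb : IsAlgebraic ℚ b) (c : KZ.FormalRep) :
    KZ.scale (a + b) (ha.add hb) c - (KZ.scale a ha c + KZ.scale b hb c) ∈ KZ.relations := by
  refine sub_mem_relations_of_forall_of (KZ.scale (a + b) (ha.add hb)) (KZ.scale a ha + KZ.scale b hb)
    (fun k r => ?_) c
  simp only [AddMonoidHom.add_apply, KZ.scale_of]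
  rw [← sub_sub]
  exact KZ.integrandAddRel_subset_relations ⟨k, r.constMul (a + b) (ha.add hb), r.constMul a ha,
    r.constMul b hb, rfl, rfl, fun x _ => by simp [add_mul], rfl⟩

/-- `scale 1 ≡ id` modulo relations. [folklore] -/
theorem scale_one_sub_mem (c : KZ.FormalRep) :
    KZ.scale 1 isAlgebraic_one c - c ∈ KZ.relations := by
  refine sub_mem_relations_of_forall_of (KZ.scale 1 isAlgebraic_one) (AddMonoidHom.id _)
    (fun k r => ?_) c
  simp only [KZ.scale_of, AddMonoidHom.id_apply]
  exact of_sub_of_mem_relations_of_eqOn rfl fun x _ => by simp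

/-- `KZ.scale` depends on the constant only (proof irrelevance). [folklore] -/
theorem scale_congr {a b : ℝ} (ha : IsAlgebraic ℚ a) (hb : IsAlgebraic ℚ b) (h : a = b) (c : KZ.FormalRep) :
    KZ.scale a ha c = KZ.scale b hb c := by
  subst h; rfl

/-- Natural numbers are algebraic. [folklore] -/
theorem isAlgebraic_natCast (n : ℕ) : IsAlgebraic ℚ (n : ℝ) := isAlgebraic_nat n

/-- `scale n ≡ n • ·` modulo relations. [folklore] -/
theorem scale_nat_sub_nsmul_mem (n : ℕ) (c : KZ.FormalRep) :
    KZ.scale (n : ℝ) (isAlgebraic_natCast n) c - n • c ∈ KZ.relations := by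
  induction n with
  | zero =>
    rw [zero_smul, sub_zero]
    have h0 := sub_mem_relations_of_forall_of (KZ.scale ((0 : ℕ) : ℝ) (isAlgebraic_natCast 0)) 0
      (fun k r => ?_) c
    · simpa using h0
    · simp only [KZ.scale_of, AddMonoidHom.zero_apply, sub_zero]
      exact of_mem_relations_of_eqOn_zero _ fun x _ => by simp
  | succ m ih =>
    have h1 := scale_add_sub_mem (m : ℝ) 1 (isAlgebraic_natCast m) isAlgebraic_one c
    have h2 := scale_one_sub_mem c
    have e : KZ.scale ((m : ℝ) + 1) ((isAlgebraic_natCast m).add isAlgebraic_one) c =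
        KZ.scale ((m + 1 : ℕ) : ℝ) (isAlgebraic_natCast (m + 1)) c :=
      scale_congr _ _ (by push_cast; rfl) c
    rw [e] at h1
    have : KZ.scale ((m + 1 : ℕ) : ℝ) (isAlgebraic_natCast (m + 1)) c - (m + 1) • c =
        (KZ.scale ((m + 1 : ℕ) : ℝ) (isAlgebraic_natCast (m + 1)) c -
          (KZ.scale (m : ℝ) (isAlgebraic_natCast m) c + KZ.scale 1 isAlgebraic_one c)) +
        (KZ.scale (m : ℝ) (isAlgebraic_natCast m) c - m • c) + (KZ.scale 1 isAlgebraic_one c - c) := by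
      rw [add_smul, one_smul]; abel
    rw [this]
    exact add_mem (add_mem h1 ih) h2

/-- **INTEGER DIVISION is a derived rule of the calculus**: `n • c ∈ relations → c ∈ relations`
(`0 < n`).  Proof: `c ≡ scale 1 c = scale (n⁻¹ · n) c ≡ scale n⁻¹ (scale n c) ≡ scale n⁻¹ (n • c)`,
and `scale` preserves relations. (Route FurushoPentagon files this as item `IntegerDivision`,
stmt-3934.) [folklore] -/
theorem mem_relations_of_nsmul_mem {n : ℕ} (hn : 0 < n) {c : KZ.FormalRep}
    (h : n • c ∈ KZ.relations) : c ∈ KZ.relations := by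
  have hn' : (n : ℝ) ≠ 0 := by exact_mod_cast hn.ne'
  have hinv : IsAlgebraic ℚ ((n : ℝ)⁻¹) := (isAlgebraic_natCast n).inv
  have h1 := scale_one_sub_mem c
  have h2 := scale_scale_sub_mem ((n : ℝ)⁻¹) (n : ℝ) hinv (isAlgebraic_natCast n) c
  have e : KZ.scale ((n : ℝ)⁻¹ * n) (hinv.mul (isAlgebraic_natCast n)) c = KZ.scale 1 isAlgebraic_one c :=
    scale_congr _ _ (inv_mul_cancel₀ hn') c
  rw [e] at h2
  have h3 : KZ.scale ((n : ℝ)⁻¹) hinv (KZ.scale (n : ℝ) (isAlgebraic_natCast n) c - n • c) ∈ KZ.relations :=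
    KZ.scale_mem_relations _ _ (scale_nat_sub_nsmul_mem n c)
  have h4 : KZ.scale ((n : ℝ)⁻¹) hinv (n • c) ∈ KZ.relations := KZ.scale_mem_relations _ _ h
  rw [map_sub] at h3
  have : c = -(KZ.scale 1 isAlgebraic_one c - c) +
      (-(KZ.scale ((n : ℝ)⁻¹) hinv (KZ.scale (n : ℝ) (isAlgebraic_natCast n) c) - KZ.scale 1 isAlgebraic_one c)) +
      (KZ.scale ((n : ℝ)⁻¹) hinv (KZ.scale (n : ℝ) (isAlgebraic_natCast n) c) -
        KZ.scale ((n : ℝ)⁻¹) hinv (n • c)) + KZ.scale ((n : ℝ)⁻¹) hinv (n • c) := by abel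
  rw [this]
  exact add_mem (add_mem (add_mem (neg_mem h1) (neg_mem h2)) h3) h4

/-- Scaling a generator by a natural number is `n` copies, modulo relations. [folklore] -/
theorem of_constMul_nat_sub_nsmul_mem {k : ℕ} (n : ℕ) (r : KZ.IntegralRep k) :
    KZ.of (r.constMul (n : ℝ) (isAlgebraic_natCast n)) - n • KZ.of r ∈ KZ.relations := by
  simpa using scale_nat_sub_nsmul_mem n (KZ.of r)

end Scaling

end Summit.KontsevichZagierPeriods.MzvKernelInKZ.Negative
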